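import Summits.ResolutionOfSingularities.ResolutionOfSingularities.Theorems.EquisingularLiftEquisingularLiftNatTowerBDoublePrimeAssembly
import Summits.ResolutionOfSingularities.ResolutionOfSingularities.Theorems.EquisingularLiftEquisingularLiftNatTowerBPointStepsFE
import Summits.ResolutionOfSingularities.ResolutionOfSingularities.Theorems.EquisingularLiftEquisingularLiftNatTowerRoundBDoublePrimeSDefs
import Summits.ResolutionOfSingularities.ResolutionOfSingularities.Theorems.EquisingularLiftEquisingularLiftNatTowerCurveStepBS
import Summits.ResolutionOfSingularities.ResolutionOfSingularities.Theorems.EquisingularLiftEquisingularLiftNatInvSStepRegular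
import Summits.ResolutionOfSingularities.ResolutionOfSingularities.Theorems.EquisingularLiftEquisingularLiftNatInvSStepSingular
import Literature.AlgebraicGeometry.Resolution.BlowupExceptionalFibreIrreducible
import Literature.AlgebraicGeometry.Resolution.PermissibleCentres
import HarnessLib

/-!
# [OURS · L1 W4.5(b) · EL♮(3) · T23-A″-S] HSUB‴(ReachTowerB″S)₃ — THE ENGINE V10‴ OF RUNG DEF-TOWER-B″-S (`ReachTowerBDoublePrimeS`: the B″ tower with the
# point plane SEEDED into the retained list) = V10″ on the left disjunct + the S-chain on the right (engine word 16d03a46d50c8ccd §S, desk R20/R21)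

res-L1-w45b-stub-4 g11 (T23-A / A′ / A″ engine owner; TAKING l.79745). Crux EL♮(3) = stmt-ResolutionOfSingularities-20148 (parent stmt-…-20038); rung‴ target =
rung″ TARGET 84453e0b4c2664ef with `ReachTowerBDoublePrime ↦ ReachTowerBDoublePrimeS` (lead-2, the 31st). OURS; NOT a statement of any manuscript ([Hironaka2017]
is a candidate under adjudication, nothing of it is asserted); AI-written, weaker than expert review. No `sorry`; standard axioms; DEF-FREE.
`--supports stmt-ResolutionOfSingularities-20148 --as helper`.

WHAT. `hsub_reachTowerBDoublePrimeS_of_fact` = res-L1-w45b-stub-2's V10″ `hsub_reachTowerBDoublePrime_of_fact` (…NatTowerBDoublePrimeAssembly) VERBATIM on the left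
disjunct of lead-1's `ReachTowerBDoublePrimeS` (…NatTowerRoundBDoublePrimeSDefs); on the right disjunct (in-carrier phase `InCarrierReachKS` carrying the plane
`S₂ := υ⁻¹{x}`, round seed `[closure υ'⁻¹(S₉ ∖ Z₉)]`) the inner invariant is
`INV_S W G β T Z K S b := ((K = ∅ ∧ InvS₀ W G β T Z S b) ∨ (TCPlus.InvS … W G β T Z K S b ∧ K-side facts)) ∧ (IsClosed S ∧ S ⊆ closure (S ∖ closure Z) ∧ ¬ T ⊆ S)`:
the KCL arm by res-type-027's A″-S twins `inv_baseS` (named input `hBaseS`, discharged in the rung by `inv_baseS` as `hBaseKCL` is by `inv_baseKCL`),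
`invS_step_regular` / `invS_step_singular`, `Tower.invB_of_invS_curveStep_FE` (p618350); the shadow-free arm (`K₂ = ∅`, non-conical `W`) through an ABSTRACT
predicate `InvS₀` with its four closure facts as named inputs (`hBaseS₀` / `hStepS₀` / `hSingS₀` / `hCurveS₀`, + the projection `hInvS₀` to `TCPlus.Inv`) — res-type-027's
shadow-free twins (R-b, l.79753) instantiate them in a thin wrapper; the plane's downstairs side facts are transported here (closure / density off the curve by
`closure_preimage_diff_subset_of_isBlowup` / `¬ T ⊆ S` by `not_closure_preimage_diff_subset`; base: the exceptional plane is irreducible,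
`IsBlowup.isIrreducible_preimage_singleton`, + `hnot`). After the curve step everything is the B″ engine unchanged: `Tower.towerPtRegB_invB₁_FE` /
`Tower.towerPtRamB_invB₁_FE` (…NatTowerBPointStepsFE), `Tower.towerRoundBDoublePrime_invB_of_fact'` (…NatTowerBDoublePrimeRoundClosure), `Tower.invB_final`.
[cite: GortzWedhorn2020, Prop. 13.91 and (13.19)] [cite: Liu2002, §8.1 and Thm. 8.1.19] [cite: Hartshorne1977, II Thm. 8.24 (b)]
-/

set_option linter.dupNamespace false -- mandated namespace `Summit.<Summit>.<Problem>` of this single-conjunct summit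
set_option linter.overlappingInstances false -- signatures carry `[IsDomain O] [IsDiscreteValuationRing O]`

noncomputable section

open CategoryTheory CategoryTheory.Limits AlgebraicGeometry TopologicalSpace Topology IsLocalRing
open Literature.AlgebraicGeometry.Resolution
open AlgebraicGeometry.Scheme.IdealSheafData
open Summit.ResolutionOfSingularities.ResolutionOfSingularities.Theses.EquisingularLift.Split
open Summit.ResolutionOfSingularities.ResolutionOfSingularities.Cruxes.EquisingularLift.StrataSplit

namespace Summit.ResolutionOfSingularities.ResolutionOfSingularities.Cruxes.EquisingularLiftNat.Sections

/-- **The exceptional plane of a point blow-up is irreducible** (a `ℙ^{m−1}`): for `x` a closed point with `𝒪_{F₁,x}` regular on an integral `F₁` that is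
not the single point `x`. [cite: Hartshorne1977, II Thm. 8.24 (b)] [OURS · downstairs side fact of the A″-S seed] -/
theorem isIrreducible_preimage_singleton_of_isRegularLocalRing {F₁ F₂ : Scheme.{0}} [IsIntegral F₁] (υ : F₂ ⟶ F₁) {x : F₁}
    (hx : IsClosed ({x} : Set F₁)) (hxreg : IsRegularLocalRing (F₁.presheaf.stalk x))
    (hυ : IsBlowup υ (vanishingIdeal (⟨{x}, hx⟩ : Closeds F₁))) (hF : ∃ y : F₁, y ≠ x) : IsIrreducible (υ ⁻¹' {x}) := by
  haveI := hxreg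
  refine hυ.isIrreducible_preimage_singleton x (stalkIdeal_vanishingIdeal_singleton hx) fun hbot => ?_
  -- `𝔪_x = ⊥`: `𝒪_{F₁,x}` is a field, so `x` is its own and only generisation — but the generic point generises to `x`
  obtain ⟨y, hy⟩ := hF
  have hgen : genericPoint F₁ ⤳ x := genericPoint_specializes x
  have hrange : genericPoint F₁ ∈ Set.range (F₁.fromSpecStalk x).base := by
    rw [Scheme.range_fromSpecStalk]; exact hgen
  obtain ⟨p, hp⟩ := hrange
  have hp' : p = closedPoint (F₁.presheaf.stalk x) := by
    apply PrimeSpectrum.ext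
    have h1 : p.asIdeal ≤ maximalIdeal _ := IsLocalRing.le_maximalIdeal p.isPrime.ne_top
    rw [hbot, le_bot_iff] at h1
    change p.asIdeal = maximalIdeal _
    rw [h1, hbot]
  have hηx : genericPoint F₁ = x := by
    rw [← hp, hp', Scheme.fromSpecStalk_closedPoint]
  -- then `F₁ = closure {x} = {x}`
  have huniv : (Set.univ : Set F₁) = {x} := by
    rw [← hx.closure_eq, ← hηx]; exact (genericPoint_spec F₁).symm
  have hyx : y ∈ ({x} : Set F₁) := huniv ▸ Set.mem_univ y
  exact hy hyx

/-- **HSUB‴(ReachTowerB″S)₃ — the engine V10‴ of the A″-S tower** (module docstring): V10″ on B″-chains; on the S-chains the inner invariant carries the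
point plane (027's `TCPlus.InvS` on the conical arm, the abstract `InvS₀` on the shadow-free arm) with its downstairs side facts, the curve step SEEDS the plane's
strict transform into the retained list, and the round phase is the B″ engine unchanged. [cite: GortzWedhorn2020, Prop. 13.91 and (13.19)]
[cite: Liu2002, §8.1 and Thm. 8.1.19] [OURS · L1 W4.5b · T23-A″-S engine] toward the rung‴ `stub_elnat_defTowerBDoublePrimeSPointResolutionThree`; NOT a
statement of the manuscript. -/
theorem hsub_reachTowerBDoublePrimeS_of_fact (k : Type) [Field k] [IsAlgClosed k]
    (O : Type) [CommRing O] [IsDomain O] [IsDiscreteValuationRing O] [IsAdicComplete (IsLocalRing.maximalIdeal O) O]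
    [IsAlgClosed (IsLocalRing.ResidueField O)] (θ : O →+* k) (hθ : Function.Surjective θ)
    (P : Scheme.{0}) (q : P ⟶ Spec (.of O)) (Y : Set P) (Ch : ∀ X' : Scheme.{0}, (X' ⟶ P) → Set X' → Prop)
    (hChStep : ∀ (X' X'' : Scheme.{0}) (σ' : X' ⟶ P) (S' : Set X') (C : X'.IdealSheafData) (τ : X'' ⟶ X'),
      Ch X' σ' S' → IsBlowup τ C → Scheme.IsRegular C.subscheme → Flat (C.subschemeι ≫ σ' ≫ q) →
      σ' '' (C.support : Set X') ⊆ {y | ¬ IsGenericPoint y Y} → (C.support : Set X') ∩ (σ' ≫ q) ⁻¹' {IsLocalRing.closedPoint O} ⊆ S' →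
      Ch X'' (τ ≫ σ') (closure (τ ⁻¹' (S' \ (C.support : Set X')))))
    (hChSplit : ∀ (X' : Scheme.{0}) (σ' : X' ⟶ P) (S' : Set X'), Ch X' σ' S' → Chain P Y X' σ' S')
    (hYsp : Y ⊆ q ⁻¹' {IsLocalRing.closedPoint O}) (hYirr : IsIrreducible Y) (hYcl : IsClosed Y) (hPint : IsIntegral P)
    (hPnoeth : IsLocallyNoetherian P) (hPreg : Scheme.IsRegular P) (hqprop : IsProper q) (hqsm : SmoothOfRelativeDimension 3 q)
    (X' : Scheme.{0}) (σ' : X' ⟶ P) (S' : Set X') (hCh' : Ch X' σ' S') (hX'int : IsIntegral X') (hX'noeth : IsLocallyNoetherian X')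
    (hX'reg : Scheme.IsRegular X') (hX'dom : IsDominant (σ' ≫ q)) (F₁ : Scheme.{0}) (hF₁ : IsIntegral F₁) (j : F₁ ⟶ X')
    (t : F₁ ⟶ Spec (.of k)) (hsq : IsPullback j t (σ' ≫ q) (Spec.map (CommRingCat.ofHom θ))) (T₁ : Set F₁) (hT₁cl : IsClosed T₁)
    (hT₁irr : IsIrreducible T₁) (hjT₁ : j '' T₁ = S') (x : F₁) (hx : IsClosed ({x} : Set F₁)) (U : X'.Opens)
    (hU : Smooth (U.ι ≫ σ' ≫ q)) (s : Spec (.of O) ⟶ X') (hs : s ≫ σ' ≫ q = 𝟙 _) (hsU : s (IsLocalRing.closedPoint O) ∈ U)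
    (hsx : s (IsLocalRing.closedPoint O) = j x)
    (hdim : ringKrullDim (X'.presheaf.stalk (s (IsLocalRing.closedPoint O))) = ((3 + 1 : ℕ) : WithBot ℕ∞))
    (hxreg : IsRegularLocalRing (F₁.presheaf.stalk x)) (hsoff : ∀ c ∈ (s.ker.support : Set X'), ¬ IsGenericPoint (σ' c) Y)
    (X₁ : Scheme.{0}) (τ₁ : X₁ ⟶ X') (hτ₁ : IsBlowup τ₁ s.ker) (hX₁int : IsIntegral X₁) (hX₁noeth : IsLocallyNoetherian X₁)
    (hX₁reg : Scheme.IsRegular X₁) (hX₁dom : IsDominant ((τ₁ ≫ σ') ≫ q)) (F₂ : Scheme.{0}) (hF₂ : IsIntegral F₂) (υ : F₂ ⟶ F₁)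
    (hυ : IsBlowup υ (vanishingIdeal (⟨{x}, hx⟩ : Closeds F₁))) (j₂ : F₂ ⟶ X₁) (t₂ : F₂ ⟶ Spec (.of k))
    (hsq₂ : IsPullback j₂ t₂ ((τ₁ ≫ σ') ≫ q) (Spec.map (CommRingCat.ofHom θ))) (hcomm : j₂ ≫ τ₁ = υ ≫ j)
    (hcarrier : (s.ker.comap τ₁).comap j₂ = (vanishingIdeal (⟨{x}, hx⟩ : Closeds F₁)).comap υ)
    (hirr₂ : IsIrreducible (closure (υ ⁻¹' (T₁ \ {x})))) (hCh₁ : Ch X₁ (τ₁ ≫ σ') (j₂ '' closure (υ ⁻¹' (T₁ \ {x}))))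
    -- ===================== THE FACT AND THE NAMED STAND-INS =====================
    -- (T-k) the embedded-curve lift at every stage / exceptional surface over `q` (res-L1-w45b-lead-2 …NatTowerRoundFourDefs p594791)
    (hFact : EmbeddedCurveLift O k θ P q)
    -- (S7′) B9 at the `ConeForm` seed with the LOCALIZED shadow trace (vii-loc) (res-type-100: `…NatConeFormConstants` → KCL twin → `hBaseKCL`)
    (hBaseKCL : ∀ W : Set F₁, x ∈ W → ¬ (υ ⁻¹' {x} ⊆ closure (υ ⁻¹' (W \ {x}))) →
        (∃ U₁ : F₁.affineOpens, x ∈ (U₁ : F₁.Opens) ∧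
          ((vanishingIdeal (⟨closure W, isClosed_closure⟩ : Closeds F₁)).ideal U₁).IsPrincipal) →
        ConeForm F₁ x W →
        TCPlus.InvKCL O k θ P q Y Ch W F₂ (𝟙 F₂) (closure (υ ⁻¹' (T₁ \ {x}))) (υ ⁻¹' {x} ∩ closure (υ ⁻¹' (W \ {x})))
          (closure (υ ⁻¹' (W \ {x}))) false)
    -- ===================== THE S-BRANCH NAMED INPUTS (res-type-027's A″-S bricks; discharged in the rung by `inv_baseS` / the shadow-free twins) =====================
    -- (S-base, conical `W`) `TCPlus.InvS` at the first point step (res-type-027 `inv_baseS`, p618345)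
    (hBaseS : ∀ W : Set F₁, x ∈ W → ¬ (υ ⁻¹' {x} ⊆ closure (υ ⁻¹' (W \ {x}))) →
        (∃ U₁ : F₁.affineOpens, x ∈ (U₁ : F₁.Opens) ∧
          ((vanishingIdeal (⟨closure W, isClosed_closure⟩ : Closeds F₁)).ideal U₁).IsPrincipal) →
        ConeForm F₁ x W →
        TCPlus.InvS O k θ P q Y Ch W F₂ (𝟙 F₂) (closure (υ ⁻¹' (T₁ \ {x}))) (υ ⁻¹' {x} ∩ closure (υ ⁻¹' (W \ {x})))
          (closure (υ ⁻¹' (W \ {x}))) (υ ⁻¹' {x}) false)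
    -- (S₀) the shadow-free S-invariant, ABSTRACT, with its projection and its four closure facts (res-type-027's R-b twins instantiate)
    (InvS₀ : Set F₁ → ∀ G : Scheme.{0}, (G ⟶ F₂) → Set G → Set G → Set G → Bool → Prop)
    (hInvS₀ : ∀ (W : Set F₁) (G : Scheme.{0}) (β : G ⟶ F₂) (T Z S : Set G) (b : Bool),
      InvS₀ W G β T Z S b → TCPlus.Inv O k θ P q Y Ch W G β T Z b)
    (hBaseS₀ : ∀ W : Set F₁, x ∈ W → ¬ (υ ⁻¹' {x} ⊆ closure (υ ⁻¹' (W \ {x}))) →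
        (∃ U₁ : F₁.affineOpens, x ∈ (U₁ : F₁.Opens) ∧
          ((vanishingIdeal (⟨closure W, isClosed_closure⟩ : Closeds F₁)).ideal U₁).IsPrincipal) →
        InvS₀ W F₂ (𝟙 F₂) (closure (υ ⁻¹' (T₁ \ {x}))) (υ ⁻¹' {x} ∩ closure (υ ⁻¹' (W \ {x}))) (υ ⁻¹' {x}) false)
    (hStepS₀ : ∀ (W : Set F₁) (G₁ G₂ : Scheme.{0}) (β : G₁ ⟶ F₂) (T Z S : Set G₁) (b : Bool)
        (y : ↥((vanishingIdeal (⟨closure Z, isClosed_closure⟩ : Closeds G₁))).subscheme) (υ₁ : G₂ ⟶ G₁)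
        (hy : IsClosed ({(((vanishingIdeal (⟨closure Z, isClosed_closure⟩ : Closeds G₁))).subschemeι y : G₁)} : Set G₁)),
        InvS₀ W G₁ β T Z S b → (((vanishingIdeal (⟨closure Z, isClosed_closure⟩ : Closeds G₁))).subschemeι y : G₁) ∈ T →
        IsRegularLocalRing (((vanishingIdeal (⟨closure Z, isClosed_closure⟩ : Closeds G₁))).subscheme.presheaf.stalk y) →
        IsRegularLocalRing (G₁.presheaf.stalk (((vanishingIdeal (⟨closure Z, isClosed_closure⟩ : Closeds G₁))).subschemeι y : G₁)) →
        IsBlowup υ₁ (vanishingIdeal (⟨{(((vanishingIdeal (⟨closure Z, isClosed_closure⟩ : Closeds G₁))).subschemeι y : G₁)}, hy⟩ : Closeds G₁)) →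
        InvS₀ W G₂ (υ₁ ≫ β) (closure (υ₁ ⁻¹' (T \ {(((vanishingIdeal (⟨closure Z, isClosed_closure⟩ : Closeds G₁))).subschemeι y : G₁)})))
          (closure (υ₁ ⁻¹' (Z \ {(((vanishingIdeal (⟨closure Z, isClosed_closure⟩ : Closeds G₁))).subschemeι y : G₁)})))
          (closure (υ₁ ⁻¹' (S \ {(((vanishingIdeal (⟨closure Z, isClosed_closure⟩ : Closeds G₁))).subschemeι y : G₁)}))) b)
    (hSingS₀ : ∀ (W : Set F₁) (G₁ G₂ : Scheme.{0}) (β : G₁ ⟶ F₂) (T Z S : Set G₁)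
        (y : ↥((vanishingIdeal (⟨closure Z, isClosed_closure⟩ : Closeds G₁))).subscheme) (υ₁ : G₂ ⟶ G₁)
        (hy : IsClosed ({(((vanishingIdeal (⟨closure Z, isClosed_closure⟩ : Closeds G₁))).subschemeι y : G₁)} : Set G₁)),
        InvS₀ W G₁ β T Z S false → (((vanishingIdeal (⟨closure Z, isClosed_closure⟩ : Closeds G₁))).subschemeι y : G₁) ∈ T →
        ¬ IsRegularLocalRing (((vanishingIdeal (⟨closure Z, isClosed_closure⟩ : Closeds G₁))).subscheme.presheaf.stalk y) →
        IsRegularLocalRing (G₁.presheaf.stalk (((vanishingIdeal (⟨closure Z, isClosed_closure⟩ : Closeds G₁))).subschemeι y : G₁)) →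
        IsBlowup υ₁ (vanishingIdeal (⟨{(((vanishingIdeal (⟨closure Z, isClosed_closure⟩ : Closeds G₁))).subschemeι y : G₁)}, hy⟩ : Closeds G₁)) →
        InvS₀ W G₂ (υ₁ ≫ β) (closure (υ₁ ⁻¹' (T \ {(((vanishingIdeal (⟨closure Z, isClosed_closure⟩ : Closeds G₁))).subschemeι y : G₁)})))
          (closure (υ₁ ⁻¹' (Z \ {(((vanishingIdeal (⟨closure Z, isClosed_closure⟩ : Closeds G₁))).subschemeι y : G₁)})))
          (closure (υ₁ ⁻¹' (S \ {(((vanishingIdeal (⟨closure Z, isClosed_closure⟩ : Closeds G₁))).subschemeι y : G₁)}))) true)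
    (hCurveS₀ : ∀ (W : Set F₁) (F₉ : Scheme.{0}) (β₉ : F₉ ⟶ F₂) (T₉ Z₉ S₉ : Set F₉) (b₉ : Bool) (hZ₉ : IsClosed Z₉) (F₁₀ : Scheme.{0})
        (υ' : F₁₀ ⟶ F₉), InvS₀ W F₉ β₉ T₉ Z₉ S₉ b₉ → Z₉.Infinite → IsClosed S₉ → S₉ ⊆ closure (S₉ \ Z₉) → ¬ T₉ ⊆ S₉ →
        Z₉ ⊆ T₉ → ¬ T₉ ⊆ Z₉ → IsBlowup υ' (vanishingIdeal (⟨Z₉, hZ₉⟩ : Closeds F₉)) →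
        Tower.InvB O k θ P q Y Ch (fun _ _ _ _ _ _ _ _ _ σ _ 𝓔 => Flat (𝓔.subschemeι ≫ σ ≫ q)) F₉ Z₉ hZ₉ F₁₀ υ' F₁₀ (𝟙 F₁₀)
          (closure (υ' ⁻¹' (T₉ \ Z₉))) (υ' ⁻¹' Z₉) [closure (υ' ⁻¹' (S₉ \ Z₉))] ∅) :
    -- ===================== THE CONCLUSION OF HSUB‴(ReachTowerB″S)₃ (T23-A″ + A″-S) =====================
    ∀ (F' : Scheme.{0}) (β : F' ⟶ F₂) (T' : Set F'), ReachTowerBDoublePrimeS F₁ F₂ υ x (closure (υ ⁻¹' (T₁ \ {x}))) F' β T' →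
      ∃ (X₉ : Scheme.{0}) (σ₉ : X₉ ⟶ P) (S₉ : Set X₉) (j₉ : F' ⟶ X₉) (t₉ : F' ⟶ Spec (.of k)),
        Ch X₉ σ₉ S₉ ∧ IsIntegral X₉ ∧ IsLocallyNoetherian X₉ ∧ Scheme.IsRegular X₉ ∧ IsDominant (σ₉ ≫ q) ∧
        IsPullback j₉ t₉ (σ₉ ≫ q) (Spec.map (CommRingCat.ofHom θ)) ∧ j₉ '' T' = S₉ ∧ IsClosed T' ∧ IsIrreducible T' ∧ IsIntegral F' := by
  intro F' β T' hReach
  rcases hReach with hReach | hReach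
  · -- the left disjunct: a B″-chain — res-L1-w45b-stub-2's V10″ by name
    exact hsub_reachTowerBDoublePrime_of_fact k O θ hθ P q Y Ch hChStep hChSplit hYsp hYirr hYcl hPint hPnoeth hPreg hqprop hqsm X' σ' S' hCh' hX'int
      hX'noeth hX'reg hX'dom F₁ hF₁ j t hsq T₁ hT₁cl hT₁irr hjT₁ x hx U hU s hs hsU hsx hdim hxreg hsoff X₁ τ₁ hτ₁ hX₁int hX₁noeth hX₁reg hX₁dom F₂
      hF₂ υ hυ j₂ t₂ hsq₂ hcomm hcarrier hirr₂ hCh₁ hFact hBaseKCL F' β T' hReach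
  -- the right disjunct: the S-chain (the point plane carried through the in-carrier phase and SEEDED into the round phase)
  classical
  haveI := hPint; haveI := hqprop; haveI := hqsm; haveI := hX'int; haveI := hX'noeth; haveI := hF₁; haveI := hX₁int; haveI := hX₁noeth
  haveI := hF₂
  obtain ⟨W, K₂, F₉, β₉, T₉, Z₉, K₉, S₉, b₉, hZ₉, F₁₀, υ', γ', E', Es', K', hxW, hnot, hWpr, -, hK₂, hinner, hZ₉T₉, hT₉Z₉, hZinf, -,
    hυ', hcl, -⟩ := hReach
  let FE : Tower.RuledDatum P := fun _ _ _ _ _ _ _ _ _ σ _ 𝓔 => Flat (𝓔.subschemeι ≫ σ ≫ q)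
  -- the special fibre of `F₂` over `x`: closed, irreducible, not inside `St_x W`, not containing `St_x T₁`
  have hEx : IsClosed (υ ⁻¹' ({x} : Set F₁)) := hx.preimage υ.continuous
  obtain ⟨y₀, hy₀⟩ := closure_nonempty_iff.mp hirr₂.nonempty
  have hExirr : IsIrreducible (υ ⁻¹' ({x} : Set F₁)) :=
    isIrreducible_preimage_singleton_of_isRegularLocalRing υ hx hxreg hυ ⟨υ y₀, fun h => hy₀.2 h⟩
  -- the carrier datum / Noetherianity read off the inner invariant (V7's `hcarOf` verbatim), KCL shape
  have hcarOfINV := Tower.hcar_of_innerInv O k θ hθ P q Y hYirr hYcl Ch hChSplit (F₁ := F₁) (F₂ := F₂)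
  have hnoethOfINV := Tower.isLocallyNoetherian_of_innerInv O k θ hθ P q Y Ch (F₁ := F₁) (F₂ := F₂)
  -- ===================== the inner invariant of the S-chain =====================
  let INVS : Set F₁ → ∀ G : Scheme.{0}, (G ⟶ F₂) → Set G → Set G → Set G → Set G → Bool → Prop :=
    fun W G β T Z K S b =>
      ((K = ∅ ∧ InvS₀ W G β T Z S b) ∨
        (TCPlus.InvS O k θ P q Y Ch W G β T Z K S b ∧ IsClosed K ∧ K ⊆ closure (K \ closure Z) ∧ K ≠ Set.univ ∧ IsClosed Z)) ∧
      (IsClosed S ∧ S ⊆ closure (S \ closure Z) ∧ ¬ T ⊆ S)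
  -- its projection to res-L1-w45b-stub-1's `TCPlus.Inv` (integrality, `T` irreducible, `T ⊄ closure Z`)
  have hINVSinv : ∀ W G β T Z K S b, INVS W G β T Z K S b → TCPlus.Inv O k θ P q Y Ch W G β T Z b := by
    intro W G β T Z K S b h
    rcases h.1 with ⟨-, h⟩ | ⟨h, -⟩
    · exact hInvS₀ W G β T Z S b h
    · exact TCPlus.invS_inv O k θ P q Y Ch h
  -- the plane's side facts through a point blow-up centred on `closure Z`
  have hSstep : ∀ (G₁ G₂ : Scheme.{0}) (υ₁ : G₂ ⟶ G₁) (T Z S : Set G₁) (y : G₁) (hy : IsClosed ({y} : Set G₁)),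
      IsLocallyNoetherian G₁ → IsIrreducible T → ¬ T ⊆ closure Z → y ∈ closure Z →
      IsBlowup υ₁ (vanishingIdeal (⟨{y}, hy⟩ : Closeds G₁)) →
      (IsClosed S ∧ S ⊆ closure (S \ closure Z) ∧ ¬ T ⊆ S) →
      (IsClosed (closure (υ₁ ⁻¹' (S \ {y}))) ∧
        closure (υ₁ ⁻¹' (S \ {y})) ⊆ closure (closure (υ₁ ⁻¹' (S \ {y})) \ closure (closure (υ₁ ⁻¹' (Z \ {y})))) ∧
        ¬ closure (υ₁ ⁻¹' (T \ {y})) ⊆ closure (υ₁ ⁻¹' (S \ {y}))) := by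
    intro G₁ G₂ υ₁ T Z S y hy hG₁ hTirr hTZ hyZ hυ₁ ⟨hScl, hSd, hTS⟩
    haveI := hG₁
    have hDsupp : ((vanishingIdeal (⟨{y}, hy⟩ : Closeds G₁) : G₁.IdealSheafData).support : Set G₁) = {y} :=
      Scheme.IdealSheafData.coe_support_vanishingIdeal _
    refine ⟨isClosed_closure, ?_, ?_⟩
    · -- dense off the transported curve (the shadow's argument of V10′ verbatim)
      have h := closure_preimage_diff_subset_of_isBlowup υ₁ _ hυ₁ S (closure Z) isClosed_closure hSd
      rw [hDsupp] at h
      refine h.trans (closure_mono fun g hg => ⟨hg.1, fun hg' => hg.2 ?_⟩)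
      rw [closure_closure] at hg'
      refine closure_mono (Set.preimage_mono ?_) hg'
      intro z hz
      exact ⟨subset_closure hz.1, hz.2⟩
    · have hTy : ¬ T ⊆ {y} := fun h => hTZ (h.trans (Set.singleton_subset_iff.mpr hyZ))
      exact not_closure_preimage_diff_subset hυ₁ hTirr hScl hy hTS hTy hDsupp.le
  -- ===================== (base) =====================
  have hbaseS : INVS W F₂ (𝟙 F₂) (closure (υ ⁻¹' (T₁ \ {x}))) (υ ⁻¹' {x} ∩ closure (υ ⁻¹' (W \ {x}))) K₂ (υ ⁻¹' {x}) false := by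
    have hZcl : IsClosed (υ ⁻¹' {x} ∩ closure (υ ⁻¹' (W \ {x}))) := hEx.inter isClosed_closure
    have hSF : IsClosed (υ ⁻¹' ({x} : Set F₁)) ∧
        υ ⁻¹' {x} ⊆ closure (υ ⁻¹' {x} \ closure (υ ⁻¹' {x} ∩ closure (υ ⁻¹' (W \ {x})))) ∧
        ¬ closure (υ ⁻¹' (T₁ \ {x})) ⊆ υ ⁻¹' {x} := by
      refine ⟨hEx, ?_, fun h => hy₀.2 (h (subset_closure hy₀))⟩
      rw [hZcl.closure_eq]
      -- the exceptional plane is irreducible and not inside `St_x W`: its part off the curve is dense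
      have h1 : (υ ⁻¹' ({x} : Set F₁) ∩ (closure (υ ⁻¹' (W \ {x})))ᶜ).Nonempty := by
        by_contra h0
        apply hnot
        intro e he
        by_contra he'
        exact h0 ⟨e, he, he'⟩
      refine (subset_closure_inter_of_isPreirreducible_of_isOpen hExirr.isPreirreducible isClosed_closure.isOpen_compl h1).trans
        (closure_mono fun e he => ⟨he.1, fun h => he.2 h.2⟩)
    rcases hK₂ with rfl | ⟨hcone, rfl⟩
    · exact ⟨Or.inl ⟨rfl, hBaseS₀ W hxW hnot hWpr⟩, hSF⟩
    · refine ⟨Or.inr ⟨hBaseS W hxW hnot hWpr hcone, isClosed_closure, ?_, ?_, hZcl⟩, hSF⟩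
      · have hZcl' : closure (υ ⁻¹' {x} ∩ closure (υ ⁻¹' (W \ {x}))) ⊆ υ ⁻¹' {x} :=
          closure_minimal Set.inter_subset_left hEx
        exact closure_minimal (fun g hg => subset_closure ⟨subset_closure hg, fun h => hg.2 (hZcl' h)⟩) isClosed_closure
      · intro huniv
        apply hnot
        rw [huniv]; exact Set.subset_univ _
  -- ===================== (step, flag kept) =====================
  have hstepS : ∀ (G₁ G₂ : Scheme.{0}) (β : G₁ ⟶ F₂) (T Z K S : Set G₁) (b : Bool)
      (y : ↥((vanishingIdeal (⟨closure Z, isClosed_closure⟩ : Closeds G₁))).subscheme) (υ₁ : G₂ ⟶ G₁)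
      (hy : IsClosed ({(((vanishingIdeal (⟨closure Z, isClosed_closure⟩ : Closeds G₁))).subschemeι y : G₁)} : Set G₁)),
      INVS W G₁ β T Z K S b → (((vanishingIdeal (⟨closure Z, isClosed_closure⟩ : Closeds G₁))).subschemeι y : G₁) ∈ T →
      IsRegularLocalRing (((vanishingIdeal (⟨closure Z, isClosed_closure⟩ : Closeds G₁))).subscheme.presheaf.stalk y) →
      IsRegularLocalRing (G₁.presheaf.stalk (((vanishingIdeal (⟨closure Z, isClosed_closure⟩ : Closeds G₁))).subschemeι y : G₁)) →
      IsBlowup υ₁ (vanishingIdeal (⟨{(((vanishingIdeal (⟨closure Z, isClosed_closure⟩ : Closeds G₁))).subschemeι y : G₁)}, hy⟩ : Closeds G₁)) →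
      INVS W G₂ (υ₁ ≫ β) (closure (υ₁ ⁻¹' (T \ {(((vanishingIdeal (⟨closure Z, isClosed_closure⟩ : Closeds G₁))).subschemeι y : G₁)})))
        (closure (υ₁ ⁻¹' (Z \ {(((vanishingIdeal (⟨closure Z, isClosed_closure⟩ : Closeds G₁))).subschemeι y : G₁)})))
        (closure (υ₁ ⁻¹' (K \ {(((vanishingIdeal (⟨closure Z, isClosed_closure⟩ : Closeds G₁))).subschemeι y : G₁)})))
        (closure (υ₁ ⁻¹' (S \ {(((vanishingIdeal (⟨closure Z, isClosed_closure⟩ : Closeds G₁))).subschemeι y : G₁)}))) b := by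
    intro G₁ G₂ β T Z K S b y υ₁ hy hI hyT hyreg' hyreg hυ₁
    have hinv := hINVSinv _ _ _ _ _ _ _ _ hI
    obtain ⟨hG₁, -, hTirr, hTZ, -⟩ := hinv
    haveI := hG₁
    haveI : IsLocallyNoetherian G₁ := hnoethOfINV W β T Z K b (by
      rcases hI.1 with ⟨hK, h⟩ | ⟨h, hrest⟩
      · exact Or.inl ⟨hK, hInvS₀ _ _ _ _ _ _ _ h⟩
      · exact Or.inr ⟨TCPlus.invS_invKCL O k θ P q Y Ch h, hrest⟩)
    have hyZ : ((vanishingIdeal (⟨closure Z, isClosed_closure⟩ : Closeds G₁)).subschemeι y : G₁) ∈ closure Z := by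
      have h1 : ((vanishingIdeal (⟨closure Z, isClosed_closure⟩ : Closeds G₁)).subschemeι y : G₁) ∈
          Set.range (vanishingIdeal (⟨closure Z, isClosed_closure⟩ : Closeds G₁)).subschemeι := ⟨y, rfl⟩
      rw [Scheme.IdealSheafData.range_subschemeι, Scheme.IdealSheafData.coe_support_vanishingIdeal] at h1
      exact h1
    refine ⟨?_, hSstep G₁ G₂ υ₁ T Z S _ hy inferInstance hTirr hTZ hyZ hυ₁ hI.2⟩
    rcases hI.1 with ⟨rfl, hI₀⟩ | ⟨hIS, hKcl, hKd, hKne, hZcl⟩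
    · refine Or.inl ⟨by simp, hStepS₀ W G₁ G₂ β T Z S b y υ₁ hy hI₀ hyT hyreg' hyreg hυ₁⟩
    · have hI₂ := invS_step_regular O k θ hθ P q Y hYsp hYirr hYcl hPnoeth hPreg Ch hChSplit hChStep W G₁ G₂ β T Z K S b y υ₁ hy hIS hZcl
        hyT hyreg' hyreg hυ₁
      refine Or.inr ⟨hI₂, isClosed_closure, ?_, ?_, isClosed_closure⟩
      · have h := closure_preimage_diff_subset_of_isBlowup υ₁ _ hυ₁ K (closure Z) isClosed_closure hKd
        rw [Scheme.IdealSheafData.coe_support_vanishingIdeal] at h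
        refine h.trans (closure_mono fun g hg => ⟨hg.1, fun hg' => hg.2 ?_⟩)
        rw [closure_closure] at hg'
        refine closure_mono (Set.preimage_mono ?_) hg'
        intro z hz
        exact ⟨subset_closure hz.1, hz.2⟩
      · exact closure_preimage_ne_univ υ₁ _ hυ₁ K {_} hKcl hKne hy
          (fun h => hTZ (fun z _ => by rw [Set.eq_univ_iff_forall] at h; rw [Set.mem_singleton_iff.mp (h z)]; exact hyZ))
          (by rw [Scheme.IdealSheafData.coe_support_vanishingIdeal]; rfl) _ (Set.preimage_mono fun z hz => hz.1)
  -- ===================== (step, flag raised) =====================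
  have hsingS : ∀ (G₁ G₂ : Scheme.{0}) (β : G₁ ⟶ F₂) (T Z K S : Set G₁)
      (y : ↥((vanishingIdeal (⟨closure Z, isClosed_closure⟩ : Closeds G₁))).subscheme) (υ₁ : G₂ ⟶ G₁)
      (hy : IsClosed ({(((vanishingIdeal (⟨closure Z, isClosed_closure⟩ : Closeds G₁))).subschemeι y : G₁)} : Set G₁)),
      INVS W G₁ β T Z K S false → (((vanishingIdeal (⟨closure Z, isClosed_closure⟩ : Closeds G₁))).subschemeι y : G₁) ∈ T →
      ¬ IsRegularLocalRing (((vanishingIdeal (⟨closure Z, isClosed_closure⟩ : Closeds G₁))).subscheme.presheaf.stalk y) →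
      IsRegularLocalRing (G₁.presheaf.stalk (((vanishingIdeal (⟨closure Z, isClosed_closure⟩ : Closeds G₁))).subschemeι y : G₁)) →
      IsBlowup υ₁ (vanishingIdeal (⟨{(((vanishingIdeal (⟨closure Z, isClosed_closure⟩ : Closeds G₁))).subschemeι y : G₁)}, hy⟩ : Closeds G₁)) →
      INVS W G₂ (υ₁ ≫ β) (closure (υ₁ ⁻¹' (T \ {(((vanishingIdeal (⟨closure Z, isClosed_closure⟩ : Closeds G₁))).subschemeι y : G₁)})))
        (closure (υ₁ ⁻¹' (Z \ {(((vanishingIdeal (⟨closure Z, isClosed_closure⟩ : Closeds G₁))).subschemeι y : G₁)})))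
        (closure (υ₁ ⁻¹' (K \ {(((vanishingIdeal (⟨closure Z, isClosed_closure⟩ : Closeds G₁))).subschemeι y : G₁)})))
        (closure (υ₁ ⁻¹' (S \ {(((vanishingIdeal (⟨closure Z, isClosed_closure⟩ : Closeds G₁))).subschemeι y : G₁)}))) true := by
    intro G₁ G₂ β T Z K S y υ₁ hy hI hyT hysing hyreg hυ₁
    have hinv := hINVSinv _ _ _ _ _ _ _ _ hI
    obtain ⟨hG₁, -, hTirr, hTZ, -⟩ := hinv
    haveI := hG₁
    haveI : IsLocallyNoetherian G₁ := hnoethOfINV W β T Z K false (by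
      rcases hI.1 with ⟨hK, h⟩ | ⟨h, hrest⟩
      · exact Or.inl ⟨hK, hInvS₀ _ _ _ _ _ _ _ h⟩
      · exact Or.inr ⟨TCPlus.invS_invKCL O k θ P q Y Ch h, hrest⟩)
    have hyZ : ((vanishingIdeal (⟨closure Z, isClosed_closure⟩ : Closeds G₁)).subschemeι y : G₁) ∈ closure Z := by
      have h1 : ((vanishingIdeal (⟨closure Z, isClosed_closure⟩ : Closeds G₁)).subschemeι y : G₁) ∈
          Set.range (vanishingIdeal (⟨closure Z, isClosed_closure⟩ : Closeds G₁)).subschemeι := ⟨y, rfl⟩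
      rw [Scheme.IdealSheafData.range_subschemeι, Scheme.IdealSheafData.coe_support_vanishingIdeal] at h1
      exact h1
    refine ⟨?_, hSstep G₁ G₂ υ₁ T Z S _ hy inferInstance hTirr hTZ hyZ hυ₁ hI.2⟩
    rcases hI.1 with ⟨rfl, hI₀⟩ | ⟨hIS, hKcl, hKd, hKne, hZcl⟩
    · refine Or.inl ⟨by simp, hSingS₀ W G₁ G₂ β T Z S y υ₁ hy hI₀ hyT hysing hyreg hυ₁⟩
    · have hI₂ := invS_step_singular O k θ hθ P q Y hYsp hYirr hYcl hPnoeth hPreg Ch hChSplit hChStep W G₁ G₂ β T Z K S y υ₁ hy hIS hZcl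
        hyT hysing hyreg hυ₁
      refine Or.inr ⟨hI₂, isClosed_closure, ?_, ?_, isClosed_closure⟩
      · have h := closure_preimage_diff_subset_of_isBlowup υ₁ _ hυ₁ K (closure Z) isClosed_closure hKd
        rw [Scheme.IdealSheafData.coe_support_vanishingIdeal] at h
        refine h.trans (closure_mono fun g hg => ⟨hg.1, fun hg' => hg.2 ?_⟩)
        rw [closure_closure] at hg'
        refine closure_mono (Set.preimage_mono ?_) hg'
        intro z hz
        exact ⟨subset_closure hz.1, hz.2⟩
      · exact closure_preimage_ne_univ υ₁ _ hυ₁ K {_} hKcl hKne hy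
          (fun h => hTZ (fun z _ => by rw [Set.eq_univ_iff_forall] at h; rw [Set.mem_singleton_iff.mp (h z)]; exact hyZ))
          (by rw [Scheme.IdealSheafData.coe_support_vanishingIdeal]; rfl) _ (Set.preimage_mono fun z hz => hz.1)
  -- ===================== the inner closure: `INVS W` at the carrier =====================
  have h₉ : INVS W F₉ β₉ T₉ Z₉ K₉ S₉ b₉ := hinner (INVS W) hbaseS
    (fun G₁ G₂ β T Z K S b y υ₁ hy hI hyT h1 h2 hbl => hstepS G₁ G₂ β T Z K S b y υ₁ hy hI hyT h1 h2 hbl)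
    (fun G₁ G₂ β T Z K S y υ₁ hy hI hyT h1 h2 hbl => hsingS G₁ G₂ β T Z K S y υ₁ hy hI hyT h1 h2 hbl)
  -- ===================== (curve): the tower invariant `INV₁` (V10's shape) at the SEED with the plane retained =====================
  let INV₁ : ∀ (F₉ : Scheme.{0}) (Z₉ : Set F₉), IsClosed Z₉ → ∀ (F₁₀ : Scheme.{0}), (F₁₀ ⟶ F₉) →
      ∀ G : Scheme.{0}, (G ⟶ F₁₀) → Set G → Set G → List (Set G) → Set G → Prop :=
    fun F₉ Z₉ hZ₉ F₁₀ υ' G γ T E Es K => (Tower.InvB O k θ P q Y Ch FE F₉ Z₉ hZ₉ F₁₀ υ' G γ T E Es K ∧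
      IsClosed K ∧ K ⊆ closure (K \ E) ∧ K ≠ Set.univ) ∧
      (∀ z : ↥(redSub F₉ Z₉ hZ₉), IsClosed ({z} : Set ↥(redSub F₉ Z₉ hZ₉)) →
        ringKrullDim ((redSub F₉ Z₉ hZ₉).presheaf.stalk z) = ((1 : ℕ) : WithBot ℕ∞)) ∧ IsLocallyNoetherian F₉
  obtain ⟨h₉I, hS₉cl, hS₉d, hTS₉⟩ := h₉
  have hKCLshape : (K₉ = ∅ ∧ TCPlus.Inv O k θ P q Y Ch W F₉ β₉ T₉ Z₉ b₉) ∨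
      (TCPlus.InvKCL O k θ P q Y Ch W F₉ β₉ T₉ Z₉ K₉ b₉ ∧ IsClosed K₉ ∧ K₉ ⊆ closure (K₉ \ closure Z₉) ∧ K₉ ≠ Set.univ ∧ IsClosed Z₉) := by
    rcases h₉I with ⟨hK, h⟩ | ⟨h, hrest⟩
    · exact Or.inl ⟨hK, hInvS₀ _ _ _ _ _ _ _ h⟩
    · exact Or.inr ⟨TCPlus.invS_invKCL O k θ P q Y Ch h, hrest⟩
  have hcar := hcarOfINV W β₉ T₉ Z₉ K₉ b₉ hZ₉ hKCLshape
  have hF₉noeth := hnoethOfINV W β₉ T₉ Z₉ K₉ b₉ hKCLshape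
  haveI := hF₉noeth
  have hS₉dense : S₉ ⊆ closure (S₉ \ Z₉) := by rw [← hZ₉.closure_eq]; exact hS₉d
  have hseed : INV₁ F₉ Z₉ hZ₉ F₁₀ υ' F₁₀ (𝟙 F₁₀) (closure (υ' ⁻¹' (T₉ \ Z₉))) (υ' ⁻¹' Z₉) [closure (υ' ⁻¹' (S₉ \ Z₉))]
      (closure (υ' ⁻¹' (K₉ \ Z₉))) := by
    rcases h₉I with ⟨rfl, hI₀⟩ | ⟨hIS, hKcl, hKd, hKne, -⟩
    · have h := hCurveS₀ W F₉ β₉ T₉ Z₉ S₉ b₉ hZ₉ F₁₀ υ' hI₀ hZinf hS₉cl hS₉dense hTS₉ hZ₉T₉ hT₉Z₉ hυ'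
      have h0 : closure (υ' ⁻¹' ((∅ : Set F₉) \ Z₉)) = ∅ := by simp
      rw [h0]
      haveI : IsIntegral F₁₀ := h.2.2.1
      exact ⟨⟨h, isClosed_empty, by simp, Set.empty_ne_univ⟩, hcar, hF₉noeth⟩
    · obtain ⟨hG, -⟩ := TCPlus.invS_inv O k θ P q Y Ch hIS
      haveI := hG
      have h := Tower.invB_of_invS_curveStep_FE O k θ hθ P q Y hYsp hYirr hYcl hPnoeth hPreg Ch hChSplit hChStep W F₉ β₉ T₉ Z₉ K₉ S₉ b₉ hZ₉ F₁₀ υ'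
        hIS hZinf hKcl hKne (hKd.trans (closure_mono fun z hz => ⟨hz.1, fun h => hz.2 (subset_closure h)⟩)) hS₉cl hS₉dense hTS₉ hZ₉T₉ hT₉Z₉ hυ'
      refine ⟨⟨h, isClosed_closure, ?_, ?_⟩, hcar, hF₉noeth⟩
      · exact closure_preimage_diff_subset_closure_diff_preimage υ' K₉ Z₉
      · obtain ⟨-, -, -, hTcl, hTirr, -⟩ := h
        refine closure_preimage_ne_univ υ' _ hυ' K₉ Z₉ hKcl hKne hZ₉ (fun h => hT₉Z₉ (h ▸ Set.subset_univ _))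
          (by rw [Scheme.IdealSheafData.coe_support_vanishingIdeal]; rfl) _ (Set.preimage_mono fun z hz => hz.1)
  -- ===================== the tower closure (pt-reg / pt-ram / round = the B″ engine unchanged) and (final) =====================
  have h' : INV₁ F₉ Z₉ hZ₉ F₁₀ υ' F' γ' T' E' Es' K' :=
    hcl (INV₁ F₉ Z₉ hZ₉ F₁₀ υ') hseed
      (Tower.towerPtRegB_invB₁_FE O k θ hθ P q Y hYsp hYirr hYcl hPnoeth hPreg Ch hChStep hChSplit F₉ Z₉ hZ₉ F₁₀ υ')
      (Tower.towerPtRamB_invB₁_FE O k θ hθ P q Y hYsp hYirr hYcl hPnoeth hPreg Ch hChStep hChSplit F₉ Z₉ hZ₉ F₁₀ υ')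
      (Tower.towerRoundBDoublePrime_invB_of_fact' O k θ hθ P q Y hYsp hYirr hYcl hPnoeth hPreg Ch hChStep hChSplit hFact Z₉ hZ₉ υ')
  exact Tower.invB_final O k θ P q Y Ch FE F₉ Z₉ hZ₉ F₁₀ υ' F' γ' T' E' Es' K' h'.1.1

end Summit.ResolutionOfSingularities.ResolutionOfSingularities.Cruxes.EquisingularLiftNat.Sections

end
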